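import Summits.KontsevichZagierPeriods.KontsevichZagierPeriods.Theorems.SoloBlindGreenA
import HarnessLib

/-!
# The two-exponent form `z^α (1-z)^β dz` on the half-plane, I: calculus

The Green datum behind the **cyclic Beta relations** `sin(πa) B(a,c) = sin(πb) B(b,c)`
(`a + b + c = 1`) is the closed form `g_{αβ}(z) dz`, `g_{αβ}(z) = z^α (1-z)^β` (principal
branches), `α = a - 1`, `β = b - 1`, on `D = {x < ½, y > 0}`.  This file: the complex derivative,
the boundary values on the real axis from the upper half-plane
(`Im g(x) = sin(πα) (-x)^α (1-x)^β` for `x < 0`, `Im g(x) = 0` for `0 < x < 1`), the symmetry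
`g_{βα}(½+iy) = conj g_{αβ}(½+iy)` on the axis of `D` (the "pair trick" that replaces the edge
`x > 1`, where the principal branches jump), boundary continuity, and the decay
`|g| ≤ y^{α+β}`, `|g| ≤ |x|^{α+β}`.

References: Whittaker–Watson, *Modern Analysis*, §12.41 (the Beta function);
Kontsevich–Zagier, *Periods* (2001), §1.2.
-/

noncomputable section

open Set Complex MeasureTheory Filter
open scoped Topology ComplexConjugate
open Literature.NumberTheory.Transcendental
open Literature.NumberTheory.Transcendental.KZ

namespace Summit.KontsevichZagierPeriods.KontsevichZagierPeriods.Theorems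

namespace SoloBlind

/-! ## The form and its derivative -/

/-- `g_{αβ}(z) = z^α (1-z)^β` (principal branches). -/
def gTwo (α β : ℝ) (z : ℂ) : ℂ := z ^ (α : ℂ) * (1 - z) ^ (β : ℂ)

/-- `g_{αβ}'(z) = α z^{α-1} (1-z)^β - β z^α (1-z)^{β-1}`. -/
def gTwoDer (α β : ℝ) (z : ℂ) : ℂ :=
  (α : ℂ) * z ^ ((α : ℂ) - 1) * (1 - z) ^ (β : ℂ) - (β : ℂ) * z ^ (α : ℂ) * (1 - z) ^ ((β : ℂ) - 1)

/-- A point of the open upper half-plane and its mirror `1 - z` lie in the slit plane. -/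
theorem mem_slitPlane_pair {x y : ℝ} (hy : 0 < y) :
    (x : ℂ) + y * I ∈ slitPlane ∧ 1 - ((x : ℂ) + y * I) ∈ slitPlane :=
  ⟨Or.inr (by simp [hy.ne']), Or.inr (by simp [hy.ne'])⟩

/-- The complex derivative of `g_{αβ}` off the cuts. -/
theorem hasDerivAt_gTwo (α β : ℝ) {z : ℂ} (h1 : z ∈ slitPlane) (h2 : 1 - z ∈ slitPlane) :
    HasDerivAt (gTwo α β) (gTwoDer α β z) z := by
  have ha := (hasDerivAt_id z).cpow_const (c := (α : ℂ)) h1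
  have hb := ((hasDerivAt_id z).const_sub 1).cpow_const (c := (β : ℂ)) h2
  have h := ha.mul hb
  have hfun : gTwo α β = fun w => w ^ (α : ℂ) * (1 - w) ^ (β : ℂ) := by
    funext w; rfl
  rw [hfun]
  refine h.congr_deriv ?_
  rw [gTwoDer]
  simp only [id]
  ring

/-- Continuity of the principal power off the cut. -/
theorem continuousAt_cpow_const_of_mem {z : ℂ} (hz : z ∈ slitPlane) (c : ℂ) :
    ContinuousAt (fun w : ℂ => w ^ c) z :=
  ((hasDerivAt_id z).cpow_const (c := c) hz).continuousAt

/-- Continuity of `w ↦ (1-w)^c` where `1 - z` is off the cut. -/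
theorem continuousAt_one_sub_cpow_const {z : ℂ} (hz : 1 - z ∈ slitPlane) (c : ℂ) :
    ContinuousAt (fun w : ℂ => (1 - w) ^ c) z :=
  ContinuousAt.comp (f := fun w : ℂ => 1 - w) (continuousAt_cpow_const_of_mem hz c) (by fun_prop)

/-- `g_{αβ}'` is continuous off the cuts. -/
theorem continuousAt_gTwoDer (α β : ℝ) {z : ℂ} (h1 : z ∈ slitPlane) (h2 : 1 - z ∈ slitPlane) :
    ContinuousAt (gTwoDer α β) z :=
  ((continuousAt_const.mul (continuousAt_cpow_const_of_mem h1 _)).mul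
    (continuousAt_one_sub_cpow_const h2 _)).sub
    ((continuousAt_const.mul (continuousAt_cpow_const_of_mem h1 _)).mul
      (continuousAt_one_sub_cpow_const h2 _))

/-! ## Boundary values on the real axis -/

/-- On `(0,1)`: `g_{αβ}(x) = x^α (1-x)^β` is real. -/
theorem gTwo_ofReal_pos {α β x : ℝ} (hx0 : 0 < x) (hx1 : x < 1) :
    gTwo α β x = ((x ^ α * (1 - x) ^ β : ℝ) : ℂ) := by
  rw [gTwo, show (1 : ℂ) - (x : ℂ) = ((1 - x : ℝ) : ℂ) by push_cast; ring,
    ← ofReal_cpow hx0.le, ← ofReal_cpow (by linarith), ← ofReal_mul]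

/-- On `(-∞,0)` (from the upper half-plane): `g_{αβ}(x) = (-x)^α (1-x)^β e^{iπα}`. -/
theorem gTwo_ofReal_neg {α β x : ℝ} (hx : x < 0) :
    gTwo α β x = (((-x) ^ α * (1 - x) ^ β : ℝ) : ℂ) * cexp (((Real.pi * α : ℝ) : ℂ) * I) := by
  rw [gTwo, ofReal_cpow_of_nonpos hx.le, ← ofReal_neg, ← ofReal_cpow (by linarith),
    show (1 : ℂ) - (x : ℂ) = ((1 - x : ℝ) : ℂ) by push_cast; ring, ← ofReal_cpow (by linarith),
    show cexp ((Real.pi : ℂ) * I * (α : ℂ)) = cexp (((Real.pi * α : ℝ) : ℂ) * I) by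
      push_cast; ring_nf]
  push_cast
  ring

/-- `Im g_{αβ}(x) = sin(πα) (-x)^α (1-x)^β` for `x < 0`. -/
theorem im_gTwo_ofReal_neg {α β x : ℝ} (hx : x < 0) :
    (gTwo α β x).im = Real.sin (Real.pi * α) * ((-x) ^ α * (1 - x) ^ β) := by
  rw [gTwo_ofReal_neg hx, im_ofReal_mul, exp_ofReal_mul_I_im, mul_comm]

/-- `Im g_{αβ}(x) = 0` for `0 < x < 1`. -/
theorem im_gTwo_ofReal_pos {α β x : ℝ} (hx0 : 0 < x) (hx1 : x < 1) : (gTwo α β x).im = 0 := by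
  rw [gTwo_ofReal_pos hx0 hx1, ofReal_im]

/-! ## The symmetry on the axis `x = ½` -/

/-- `conj (w^e) = (conj w)^e` for real `e` and `Re w > 0`. -/
theorem conj_cpow_ofReal_of_re_pos {w : ℂ} (hw : 0 < w.re) (e : ℝ) :
    conj (w ^ (e : ℂ)) = conj w ^ (e : ℂ) := by
  have harg : w.arg ≠ Real.pi := fun h => by
    have h' := (arg_eq_pi_iff.mp h).1
    linarith
  have h := conj_cpow w (e : ℂ) harg
  rw [conj_ofReal] at h
  exact h.symm

/-- **The pair trick**: `g_{βα}(½+iy) = conj g_{αβ}(½+iy)`. -/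
theorem gTwo_swap_half (α β y : ℝ) :
    gTwo β α (((1 / 2 : ℝ) : ℂ) + y * I) = conj (gTwo α β (((1 / 2 : ℝ) : ℂ) + y * I)) := by
  have hz : conj (((1 / 2 : ℝ) : ℂ) + y * I) = 1 - ((((1 / 2 : ℝ) : ℂ)) + y * I) := by
    apply Complex.ext
    · simp; norm_num
    · simp
  have h1z : conj (1 - ((((1 / 2 : ℝ) : ℂ)) + y * I)) = ((1 / 2 : ℝ) : ℂ) + y * I := by
    rw [map_sub, map_one, hz, sub_sub_cancel]
  have hre1 : 0 < ((((1 / 2 : ℝ) : ℂ)) + y * I).re := by simp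
  have hre2 : 0 < (1 - ((((1 / 2 : ℝ) : ℂ)) + y * I)).re := by simp; norm_num
  rw [gTwo, gTwo, map_mul, conj_cpow_ofReal_of_re_pos hre1, conj_cpow_ofReal_of_re_pos hre2, hz,
    h1z, mul_comm]

/-- Hence `Re g_{βα}(½+iy) = Re g_{αβ}(½+iy)`. -/
theorem re_gTwo_swap_half (α β y : ℝ) :
    (gTwo β α (((1 / 2 : ℝ) : ℂ) + y * I)).re = (gTwo α β (((1 / 2 : ℝ) : ℂ) + y * I)).re := by
  rw [gTwo_swap_half, conj_re]

/-! ## Boundary continuity -/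

/-- Continuity of `y ↦ g_{αβ}(x+iy)` from the closed upper half-plane at `y = 0`, for
`x < ½`, `x ≠ 0`. -/
theorem continuousWithinAt_gTwo (α β : ℝ) {x : ℝ} (hx : x < 1 / 2) (hx0 : x ≠ 0) :
    ContinuousWithinAt (fun y : ℝ => gTwo α β (x + y * I)) (Ici 0) 0 := by
  have hlin : Continuous fun y : ℝ => (x : ℂ) + y * I := by fun_prop
  have h2 : ContinuousAt (fun y : ℝ => (1 - ((x : ℂ) + y * I)) ^ (β : ℂ)) 0 := by
    have hs : 1 - ((x : ℂ) + ((0 : ℝ) : ℂ) * I) ∈ slitPlane := Or.inl (by simp; linarith)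
    have h := (continuousAt_one_sub_cpow_const hs (β : ℂ)).comp
      (f := fun y : ℝ => (x : ℂ) + y * I) hlin.continuousAt
    exact h
  rcases lt_or_gt_of_ne hx0 with hneg | hpos
  · have h1 : ContinuousWithinAt (fun y : ℝ => ((x : ℂ) + y * I) ^ (α : ℂ)) (Ici 0) 0 := by
      have hc := continuousWithinAt_cpow_upper (e := α) (w₀ := (x : ℂ) + ((0 : ℝ) : ℂ) * I)
        (by simpa using hneg) (by simp)
      have h := hc.comp (f := fun y : ℝ => (x : ℂ) + y * I) hlin.continuousWithinAt
        fun y hy => by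
          show 0 ≤ ((x : ℂ) + y * I).im
          simpa using mem_Ici.mp hy
      exact h
    simpa only [gTwo, Pi.mul_def] using h1.mul h2.continuousWithinAt
  · have h1 : ContinuousAt (fun y : ℝ => ((x : ℂ) + y * I) ^ (α : ℂ)) 0 := by
      have hs : (x : ℂ) + ((0 : ℝ) : ℂ) * I ∈ slitPlane := Or.inl (by simpa using hpos)
      have h := (continuousAt_cpow_const_of_mem hs (α : ℂ)).comp
        (f := fun y : ℝ => (x : ℂ) + y * I) hlin.continuousAt
      exact h
    simpa only [gTwo, Pi.mul_def] using (h1.mul h2).continuousWithinAt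

/-! ## Size and decay -/

/-- `|g_{αβ}(z)| = |z|^α |1-z|^β`. -/
theorem norm_gTwo (α β : ℝ) (z : ℂ) : ‖gTwo α β z‖ = ‖z‖ ^ α * ‖1 - z‖ ^ β := by
  rw [gTwo, norm_mul, norm_cpow_real, norm_cpow_real]

/-- `|g_{αβ}(x+iy)| ≤ y^{α+β}` for `α, β ≤ 0`, `y > 0`. -/
theorem norm_gTwo_le_of_im {α β x y : ℝ} (hα : α ≤ 0) (hβ : β ≤ 0) (hy : 0 < y) :
    ‖gTwo α β (x + y * I)‖ ≤ y ^ (α + β) := by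
  have h1 : y ≤ ‖(x : ℂ) + y * I‖ := by
    have h := abs_im_le_norm ((x : ℂ) + y * I)
    rwa [show ((x : ℂ) + y * I).im = y by simp, abs_of_pos hy] at h
  have h2 : y ≤ ‖1 - ((x : ℂ) + y * I)‖ := by
    have h := abs_im_le_norm (1 - ((x : ℂ) + y * I))
    rwa [show (1 - ((x : ℂ) + y * I)).im = -y by simp, abs_neg, abs_of_pos hy] at h
  rw [norm_gTwo, Real.rpow_add hy]
  exact mul_le_mul (Real.rpow_le_rpow_of_nonpos hy h1 hα)
    (Real.rpow_le_rpow_of_nonpos hy h2 hβ) (Real.rpow_nonneg (norm_nonneg _) _)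
    (Real.rpow_nonneg hy.le _)

/-- `|g_{αβ}(x+iy)| ≤ (-x)^{α+β}` for `α, β ≤ 0`, `x < 0`. -/
theorem norm_gTwo_le_of_re {α β x : ℝ} (hα : α ≤ 0) (hβ : β ≤ 0) (hx : x < 0) (y : ℝ) :
    ‖gTwo α β (x + y * I)‖ ≤ (-x) ^ (α + β) := by
  have hx' : 0 < -x := neg_pos.mpr hx
  have h1 : -x ≤ ‖(x : ℂ) + y * I‖ := by
    have h := abs_re_le_norm ((x : ℂ) + y * I)
    rwa [show ((x : ℂ) + y * I).re = x by simp, abs_of_neg hx] at h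
  have h2 : -x ≤ ‖1 - ((x : ℂ) + y * I)‖ := by
    have h := abs_re_le_norm (1 - ((x : ℂ) + y * I))
    rw [show (1 - ((x : ℂ) + y * I)).re = 1 - x by simp, abs_of_pos (by linarith)] at h
    linarith
  rw [norm_gTwo, Real.rpow_add hx']
  exact mul_le_mul (Real.rpow_le_rpow_of_nonpos hx' h1 hα)
    (Real.rpow_le_rpow_of_nonpos hx' h2 hβ) (Real.rpow_nonneg (norm_nonneg _) _)
    (Real.rpow_nonneg hx'.le _)

/-- `g_{αβ}(x+iy) → 0` as `y → +∞` (`α, β ≤ 0`, `α + β < 0`). -/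
theorem tendsto_gTwo_atTop {α β : ℝ} (hα : α ≤ 0) (hβ : β ≤ 0) (hs : α + β < 0) (x : ℝ) :
    Tendsto (fun y : ℝ => gTwo α β (x + y * I)) atTop (𝓝 0) := by
  have hlim : Tendsto (fun y : ℝ => y ^ (α + β)) atTop (𝓝 0) := by
    have h := tendsto_rpow_neg_atTop (by linarith : 0 < -(α + β))
    simpa using h
  refine squeeze_zero_norm' ?_ hlim
  filter_upwards [eventually_gt_atTop 0] with y hy
  exact norm_gTwo_le_of_im hα hβ hy

/-- `g_{αβ}(x+iy) → 0` as `x → -∞` (`α, β ≤ 0`, `α + β < 0`). -/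
theorem tendsto_gTwo_atBot {α β : ℝ} (hα : α ≤ 0) (hβ : β ≤ 0) (hs : α + β < 0) (y : ℝ) :
    Tendsto (fun x : ℝ => gTwo α β (x + y * I)) atBot (𝓝 0) := by
  have hlim : Tendsto (fun x : ℝ => (-x) ^ (α + β)) atBot (𝓝 0) := by
    have h := (tendsto_rpow_neg_atTop (by linarith : 0 < -(α + β))).comp tendsto_neg_atBot_atTop
    simpa [Function.comp_def] using h
  refine squeeze_zero_norm' ?_ hlim
  filter_upwards [eventually_lt_atBot 0] with x hx
  exact norm_gTwo_le_of_re hα hβ hx y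

end SoloBlind

end Summit.KontsevichZagierPeriods.KontsevichZagierPeriods.Theorems
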